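import Summits.QuantumFields.GaugeBoot.OneOverNContraction
import Summits.QuantumFields.GaugeBoot.TwistMergeLocality
import HarnessLib

/-!
# The `1/N` expansion to all orders, I: propagation of the a priori bound (gauge-boot, ADDENDUM 30 part A)

HONEST FRAMING (cell `pub-gaugeboot`, page 1 of every file): the venture produces certified bounds
on lattice expectations at stated coupling, gauge group, dimension and torus size; NOT a mass gap,
NOT a continuum limit, NOT a string tension; NOT Yang–Mills-summit-bearing (barriers
`FixedCouplingUltralocality`, `PerturbativeInvisibility`).  Strong-coupling `SO(N)` lattice gauge theory with free boundary
condition at finite `N` and finite volume (S. Chatterjee, Comm. Math. Phys. **366** (2019); the `1/N` expansion: S. Chatterjee,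
J. Jafarov, arXiv:1604.04777); nothing about four-dimensional continuum Yang–Mills or a mass gap.

## Content

The analytic engine of the lane's proof of the `1/N` EXPANSION TO ALL ORDERS (Chatterjee–Jafarov, Theorem 3.1 (ii)): the orders are
climbed through the remainders `R_{k+1} = N (R_k − f_k)`, and what has to be propagated from order to order is an A PRIORI BOUND
`|R_k(t)| ≤ B_k · K_k^{ι(t)} Π(t)` for loop sequences `t` deep enough inside the box (depth `k·m` with `3N(3/4)^m ≤ 1`), uniformly
in `N` and in the volume (the source's Lemma 5.4 is the printed counterpart, with a different mechanism).

★ `apriori_step` — the abstract step.  Data: functions `Q` («`R_k`»), `P` («`R_{k−1}`»), `g` («`f_k`») on loop sequences with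
`Q(∅) = g(∅)`; a priori bounds `|Q|, |P| ≤ B Φ_K` at radius `c` and `|g| ≤ B Φ_K`; and the exact LINEARISED EQUATION WITH SOURCE
`|t|(Q−g)(t) − RHS(Q−g)(t) = N⁻¹ ( |t| Q(t) + Σ_{𝕋⁻(t)} Q − Σ_{𝕋⁺(t)} Q + Σ_{𝕄⁻(t)} P − Σ_{𝕄⁺(t)} P )` at every genuine non-null `t`
with its unit neighbourhood in `Λ`.  Conclusion: at radius `c + m`, `3N(3/4)^m ≤ 1`, `|N(Q − g)(t)| ≤ 21 B · Φ_{K'}(t)` for any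
`K' ≥ 64K²` inside the contraction regime `2/K' + 1024(d−1)K'⁴|β| ≤ 3/4`.  Proof: the twisting/merger terms of the source are
`≤ 4|t|² B (4K)^{|t|} ≤ 4 B |t| Φ_{K'}(t)` (siblings `TwistMergeLocality`, `FiniteNSymmetrizedDefect`), so the source is
`≤ (5B/N)|t|Φ_{K'}(t)`, the leaves carry `2BΦ_{K'}`, and `contraction_iterate` gives `|Q − g| ≤ (2B θ^m + 20B/N) Φ_{K'}`.

Everything is `[folklore]` given the source and ADDENDA 28–29.
-/

noncomputable section

open Finset Filter Topology
open Literature.Probability.LatticeModels (Site)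
open Literature.MathematicalPhysics.QuantumFieldTheory (latticeNorm)
open Literature.MathematicalPhysics.QuantumFieldTheory.Chatterjee2019LargeN
open Literature.MathematicalPhysics.QuantumFieldTheory.Chatterjee2019LargeN.CoeffCatalanBoundProof

namespace Summit.QuantumFields.GaugeBoot

namespace StringDuality

variable {d : ℕ}

/-! ## Small tools -/

/-- Neighbourhood conditions are monotone in the radius. [folklore] -/
theorem ball_mono {Λ : Finset (Site d)} {r r' : ℝ} (hrr' : r' ≤ r) {s : LoopSeq d}
    (hs : ∀ l ∈ s, ∀ a ∈ l, ∀ v : Site d,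
      latticeNorm (v - DEdge.src a) ≤ r ∨ latticeNorm (v - DEdge.tgt a) ≤ r → v ∈ Λ) :
    ∀ l ∈ s, ∀ a ∈ l, ∀ v : Site d,
      latticeNorm (v - DEdge.src a) ≤ r' ∨ latticeNorm (v - DEdge.tgt a) ≤ r' → v ∈ Λ := by
  intro l hl a ha v hv
  refine hs l hl a ha v ?_
  rcases hv with hv | hv
  · exact Or.inl (hv.trans hrr')
  · exact Or.inr (hv.trans hrr')

/-- The Catalan weight is monotone in `K`. [cite: Chatterjee2019LargeN, Lemma 10.1 (the weight K^{ι(s)} Π C)] -/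
theorem weight_mono {K K' : ℝ} (hK : 0 ≤ K) (hKK' : K ≤ K') (s : LoopSeq d) :
    K ^ s.index * catProd s ≤ K' ^ s.index * catProd s :=
  mul_le_mul_of_nonneg_right (pow_le_pow_left₀ hK hKK' _) (catProd_nonneg _)

/-- A value of the `K`-class at a loop sequence no longer than `t` is controlled by the `K'`-weight of `t` with a factor `|t|`
to spare: `|t| · K^{ι(u)} Π(u) ≤ K'^{ι(t)} Π(t)` whenever `|u| ≤ |t|`, `K ≥ 1` and `64K² ≤ K'`.
[cite: Chatterjee2019LargeN, Lemma 9.7 (ι ≥ |s|/2), Lemma 10.1] -/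
theorem len_mul_weight_le_weight {K K' : ℝ} (hK : 1 ≤ K) (hKK' : 64 * K ^ 2 ≤ K') {t u : LoopSeq d} (ht : IsLoopSeq t)
    (hut : u.len ≤ t.len) : (t.len : ℝ) * (K ^ u.index * catProd u) ≤ K' ^ t.index * catProd t := by
  have hK0 : 0 ≤ K := by linarith
  have h1 : K ^ u.index * catProd u ≤ (4 * K) ^ t.len := by
    calc K ^ u.index * catProd u ≤ K ^ u.len * 4 ^ u.len :=
          mul_le_mul (pow_le_pow_right₀ hK (Nat.sub_le _ _)) (catProd_le_four_pow u) (catProd_nonneg u) (by positivity)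
      _ = (4 * K) ^ u.len := by rw [mul_pow, mul_comm]
      _ ≤ (4 * K) ^ t.len := pow_le_pow_right₀ (by linarith) hut
  have h2 : (t.len : ℝ) ≤ 2 ^ t.len := by exact_mod_cast (Nat.lt_two_pow_self).le
  have h3 : (8 * K) ^ t.len ≤ K' ^ t.index * catProd t :=
    pow_len_le_weight (L := 8 * K) (by linarith) (by nlinarith) ht
  calc (t.len : ℝ) * (K ^ u.index * catProd u) ≤ 2 ^ t.len * (4 * K) ^ t.len :=
        mul_le_mul h2 h1 (mul_nonneg (pow_nonneg hK0 _) (catProd_nonneg _)) (by positivity)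
    _ = (8 * K) ^ t.len := by rw [← mul_pow]; ring
    _ ≤ K' ^ t.index * catProd t := h3

/-- A sum of at most `|t|²` terms each bounded by the `K`-class at loop sequences no longer than `t` is at most
`|t| B K'^{ι(t)} Π(t)`. [cite: Chatterjee2019LargeN, §2.2 (|𝕋^±(s)|, |𝕄^±(s)| ≤ |s|²)] -/
theorem sum_le_len_mul_weight {ι : Type*} [Fintype ι] {K K' B : ℝ} (hK : 1 ≤ K) (hKK' : 64 * K ^ 2 ≤ K') (hB : 0 ≤ B)
    {t : LoopSeq d} (ht : IsLoopSeq t) (hι : Fintype.card ι ≤ t.len ^ 2) (F : ι → ℝ) (r : ι → LoopSeq d)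
    (hr : ∀ i, (r i).len ≤ t.len) (hF : ∀ i, |F i| ≤ B * (K ^ (r i).index * catProd (r i))) :
    |∑ i, F i| ≤ (t.len : ℝ) * (B * (K' ^ t.index * catProd t)) := by
  have hK0 : 0 ≤ K := by linarith
  have hK'0 : 0 ≤ K' := by nlinarith
  have hΦ0 : 0 ≤ K' ^ t.index * catProd t := mul_nonneg (pow_nonneg hK'0 _) (catProd_nonneg _)
  -- each term is at most `B (4K)^{|t|}`, and `|t| (4K)^{|t|} ≤ Φ'`
  have hterm : ∀ i, (t.len : ℝ) * |F i| ≤ B * (K' ^ t.index * catProd t) := by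
    intro i
    calc (t.len : ℝ) * |F i| ≤ (t.len : ℝ) * (B * (K ^ (r i).index * catProd (r i))) :=
          mul_le_mul_of_nonneg_left (hF i) (Nat.cast_nonneg _)
      _ = B * ((t.len : ℝ) * (K ^ (r i).index * catProd (r i))) := by ring
      _ ≤ B * (K' ^ t.index * catProd t) := mul_le_mul_of_nonneg_left (len_mul_weight_le_weight hK hKK' ht (hr i)) hB
  by_cases hlen : t.len = 0
  · have hcard : Fintype.card ι = 0 := by rw [hlen] at hι; simpa using hι
    haveI : IsEmpty ι := Fintype.card_eq_zero_iff.mp hcard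
    rw [Finset.univ_eq_empty, Finset.sum_empty, abs_zero]
    positivity
  have hlen' : (0 : ℝ) < t.len := by exact_mod_cast Nat.pos_of_ne_zero hlen
  calc |∑ i, F i| ≤ ∑ i, |F i| := Finset.abs_sum_le_sum_abs _ _
    _ ≤ ∑ _i : ι, B * (K' ^ t.index * catProd t) / t.len := by
        refine Finset.sum_le_sum fun i _ => ?_
        rw [le_div_iff₀ hlen', mul_comm]
        exact hterm i
    _ = (Fintype.card ι : ℝ) * (B * (K' ^ t.index * catProd t) / t.len) := by
        rw [Finset.sum_const, Finset.card_univ, nsmul_eq_mul]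
    _ ≤ ((t.len : ℝ) ^ 2) * (B * (K' ^ t.index * catProd t) / t.len) := by
        refine mul_le_mul_of_nonneg_right (by exact_mod_cast hι) (div_nonneg (mul_nonneg hB hΦ0) hlen'.le)
    _ = (t.len : ℝ) * (B * (K' ^ t.index * catProd t)) := by field_simp

/-! ## The a priori step -/

/-- ★ **Propagation of the a priori bound to the next order.**  Let `K ≥ 4`, `K' ≥ 64K²`, `B ≥ 0`, `N ≥ 1`, `3N(3/4)^m ≤ 1`,
`2/K' + |β|·1024(d−1)K'⁴ ≤ 3/4`.  Let `Q, P, g : 𝒮 → ℝ` with `Q(∅) = g(∅)`, `|Q(t)|, |P(t)| ≤ B Φ_K(t)` for genuine `t` whose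
`c`-neighbourhood lies in `Λ`, `|g| ≤ B Φ_K` on genuine loop sequences, and suppose the linearised equation with source
`|t|(Q−g)(t) − (Σ_{𝕊⁻}(Q−g) − Σ_{𝕊⁺}(Q−g) + βΣ_{𝔻⁻}(Q−g) − βΣ_{𝔻⁺}(Q−g)) = N⁻¹(|t|Q(t) + Σ_{𝕋⁻}Q − Σ_{𝕋⁺}Q + Σ_{𝕄⁻}P − Σ_{𝕄⁺}P)`
holds at every genuine non-null `t` with its unit neighbourhood in `Λ`.  Then `|N (Q(t) − g(t))| ≤ 21B Φ_{K'}(t)` for every genuine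
`t` whose `(c+m)`-neighbourhood lies in `Λ`.
[cite: ChatterjeeJafarov2016OneOverN, Lemma 5.4 (the printed a priori bound); Chatterjee2019LargeN, Theorem 3.6, Lemma 10.1] -/
theorem apriori_step {K K' B β : ℝ} (hK4 : 4 ≤ K) (hKK' : 64 * K ^ 2 ≤ K') (hB : 0 ≤ B)
    (hθ : 2 / K' + |β| * (2 * ((2 * (d - 1) : ℕ) : ℝ) * 256 * K' ^ 4) ≤ 3 / 4)
    {Λ : Finset (Site d)} {N : ℕ} (hN : 1 ≤ N) {m : ℕ} (hm : 3 * (N : ℝ) * (3 / 4 : ℝ) ^ m ≤ 1) (c : ℕ)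
    (Q P g : LoopSeq d → ℝ) (h0 : Q [] = g [])
    (hQ : ∀ t : LoopSeq d, IsLoopSeq t →
      (∀ l ∈ t, ∀ a ∈ l, ∀ v : Site d,
        latticeNorm (v - DEdge.src a) ≤ (c : ℕ) ∨ latticeNorm (v - DEdge.tgt a) ≤ (c : ℕ) → v ∈ Λ) →
      |Q t| ≤ B * (K ^ t.index * catProd t))
    (hP : ∀ t : LoopSeq d, IsLoopSeq t →
      (∀ l ∈ t, ∀ a ∈ l, ∀ v : Site d,
        latticeNorm (v - DEdge.src a) ≤ (c : ℕ) ∨ latticeNorm (v - DEdge.tgt a) ≤ (c : ℕ) → v ∈ Λ) →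
      |P t| ≤ B * (K ^ t.index * catProd t))
    (hg : ∀ t : LoopSeq d, IsLoopSeq t → |g t| ≤ B * (K ^ t.index * catProd t))
    (hE : ∀ t : LoopSeq d, IsLoopSeq t → t ≠ [] →
      (∀ l ∈ t, ∀ a ∈ l, ∀ v : Site d,
        latticeNorm (v - DEdge.src a) ≤ 1 ∨ latticeNorm (v - DEdge.tgt a) ≤ 1 → v ∈ Λ) →
      (t.len : ℝ) * (Q t - g t) -
          ((∑ o : InvIdx t, (Q (t.negSplitAt o) - g (t.negSplitAt o)))
            - (∑ o : SameIdx t, (Q (t.posSplitAt o) - g (t.posSplitAt o)))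
            + β * (∑ o : DeformIdx t, (Q (t.negDeformAt o) - g (t.negDeformAt o)))
            - β * (∑ o : DeformIdx t, (Q (t.posDeformAt o) - g (t.posDeformAt o)))) =
        (1 / (N : ℝ)) * ((t.len : ℝ) * Q t
          + ((∑ o : SameIdx t, Q (t.negTwistAt o)) - ∑ o : InvIdx t, Q (t.posTwistAt o))
          + ((∑ o : MergeIdx t, P (t.negMergeAt o)) - ∑ o : MergeIdx t, P (t.posMergeAt o)))) :
    ∀ t : LoopSeq d, IsLoopSeq t →
      (∀ l ∈ t, ∀ a ∈ l, ∀ v : Site d,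
        latticeNorm (v - DEdge.src a) ≤ ((c + m : ℕ) : ℝ) ∨ latticeNorm (v - DEdge.tgt a) ≤ ((c + m : ℕ) : ℝ) → v ∈ Λ) →
      |(N : ℝ) * (Q t - g t)| ≤ 21 * B * (K' ^ t.index * catProd t) := by
  have hK1 : 1 ≤ K := by linarith
  have hK0 : 0 ≤ K := by linarith
  have hKK'1 : K ≤ K' := by nlinarith
  have hK'4 : 4 ≤ K' := by nlinarith
  have hK'0 : 0 ≤ K' := by linarith
  have hN0 : (0 : ℝ) < N := by exact_mod_cast hN
  -- the depth grading
  let Good : ℕ → LoopSeq d → Prop := fun j u => ∀ l ∈ u, ∀ a ∈ l, ∀ v : Site d,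
    latticeNorm (v - DEdge.src a) ≤ ((c + j : ℕ) : ℝ) ∨ latticeNorm (v - DEdge.tgt a) ≤ ((c + j : ℕ) : ℝ) → v ∈ Λ
  set D : LoopSeq d → ℝ := fun u => Q u - g u with hD
  have hD0 : D [] = 0 := by simp only [hD, h0, sub_self]
  -- radius `c` is available at every level
  have hc_of : ∀ (j : ℕ) (u : LoopSeq d), Good j u → ∀ l ∈ u, ∀ a ∈ l, ∀ v : Site d,
      latticeNorm (v - DEdge.src a) ≤ (c : ℕ) ∨ latticeNorm (v - DEdge.tgt a) ≤ (c : ℕ) → v ∈ Λ := by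
    intro j u hu
    exact ball_mono (by exact_mod_cast Nat.le_add_right c j) hu
  -- leaves
  have hleaf : ∀ u : LoopSeq d, IsLoopSeq u → Good 0 u → |D u| ≤ 2 * B * (K' ^ u.index * catProd u) := by
    intro u hu hg0
    have h1 := hQ u hu (hc_of 0 u hg0)
    have h2 := hg u hu
    have h3 := weight_mono hK0 hKK'1 u
    calc |D u| ≤ |Q u| + |g u| := abs_sub _ _
      _ ≤ 2 * B * (K ^ u.index * catProd u) := by linarith
      _ ≤ 2 * B * (K' ^ u.index * catProd u) := mul_le_mul_of_nonneg_left h3 (by positivity)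
  -- inner nodes
  have hnode : ∀ (j : ℕ) (u : LoopSeq d), Good (j + 1) u →
      (IsLoopSeq u → u ≠ [] →
        |(u.len : ℝ) * D u -
          ((∑ o : InvIdx u, D (u.negSplitAt o)) - (∑ o : SameIdx u, D (u.posSplitAt o))
            + β * (∑ o : DeformIdx u, D (u.negDeformAt o)) - β * (∑ o : DeformIdx u, D (u.posDeformAt o)))| ≤
          5 * B / N * u.len * (K' ^ u.index * catProd u)) ∧
      (∀ o : SameIdx u, Good j (u.posSplitAt o)) ∧ (∀ o : InvIdx u, Good j (u.negSplitAt o)) ∧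
      (∀ o : DeformIdx u, Good j (u.posDeformAt o)) ∧ (∀ o : DeformIdx u, Good j (u.negDeformAt o)) := by
    intro j u hgu
    have hcomp := ball_compatible Λ (c + j) u (by simpa only [Nat.add_assoc] using hgu)
    refine ⟨fun hu hne => ?_, hcomp.2.1, hcomp.2.2.1, hcomp.2.2.2.1, hcomp.2.2.2.2⟩
    have hcu := hc_of (j + 1) u hgu
    have htm := ball_twist_merge hcu
    have hΦ0 : 0 ≤ K' ^ u.index * catProd u := mul_nonneg (pow_nonneg hK'0 _) (catProd_nonneg _)
    rw [hD]
    simp only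
    rw [hE u hu hne hcomp.1, abs_mul, abs_of_pos (by positivity : (0 : ℝ) < 1 / N)]
    -- the four signed sums of the source
    have e1 : |(u.len : ℝ) * Q u| ≤ (u.len : ℝ) * (B * (K' ^ u.index * catProd u)) := by
      rw [abs_mul, abs_of_nonneg (Nat.cast_nonneg _)]
      exact mul_le_mul_of_nonneg_left ((hQ u hu hcu).trans (mul_le_mul_of_nonneg_left (weight_mono hK0 hKK'1 u) hB))
        (Nat.cast_nonneg _)
    have e2 : |∑ o : SameIdx u, Q (u.negTwistAt o)| ≤ (u.len : ℝ) * (B * (K' ^ u.index * catProd u)) :=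
      sum_le_len_mul_weight hK1 hKK' hB hu (card_sameIdx_le u) _ (fun o => u.negTwistAt o)
        (fun o => len_negTwistAt_le u o) (fun o => hQ _ (hu.negTwistAt o) (htm.1 o))
    have e3 : |∑ o : InvIdx u, Q (u.posTwistAt o)| ≤ (u.len : ℝ) * (B * (K' ^ u.index * catProd u)) :=
      sum_le_len_mul_weight hK1 hKK' hB hu (card_invIdx_le u) _ (fun o => u.posTwistAt o)
        (fun o => len_posTwistAt_le u o) (fun o => hQ _ (hu.posTwistAt o) (htm.2.1 o))
    have e4 : |∑ o : MergeIdx u, P (u.negMergeAt o)| ≤ (u.len : ℝ) * (B * (K' ^ u.index * catProd u)) :=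
      sum_le_len_mul_weight hK1 hKK' hB hu (card_mergeIdx_le u) _ (fun o => u.negMergeAt o)
        (fun o => len_negMergeAt_le u o) (fun o => hP _ (hu.negMergeAt o) (htm.2.2.2 o))
    have e5 : |∑ o : MergeIdx u, P (u.posMergeAt o)| ≤ (u.len : ℝ) * (B * (K' ^ u.index * catProd u)) :=
      sum_le_len_mul_weight hK1 hKK' hB hu (card_mergeIdx_le u) _ (fun o => u.posMergeAt o)
        (fun o => len_posMergeAt_le u o) (fun o => hP _ (hu.posMergeAt o) (htm.2.2.1 o))
    have hsrc : |(u.len : ℝ) * Q u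
        + ((∑ o : SameIdx u, Q (u.negTwistAt o)) - ∑ o : InvIdx u, Q (u.posTwistAt o))
        + ((∑ o : MergeIdx u, P (u.negMergeAt o)) - ∑ o : MergeIdx u, P (u.posMergeAt o))| ≤
        5 * ((u.len : ℝ) * (B * (K' ^ u.index * catProd u))) := by
      calc _ ≤ |(u.len : ℝ) * Q u| + |(∑ o : SameIdx u, Q (u.negTwistAt o)) - ∑ o : InvIdx u, Q (u.posTwistAt o)|
            + |(∑ o : MergeIdx u, P (u.negMergeAt o)) - ∑ o : MergeIdx u, P (u.posMergeAt o)| := abs_add_three _ _ _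
        _ ≤ (u.len : ℝ) * (B * (K' ^ u.index * catProd u))
            + ((u.len : ℝ) * (B * (K' ^ u.index * catProd u)) + (u.len : ℝ) * (B * (K' ^ u.index * catProd u)))
            + ((u.len : ℝ) * (B * (K' ^ u.index * catProd u)) + (u.len : ℝ) * (B * (K' ^ u.index * catProd u))) :=
            add_le_add (add_le_add e1 ((abs_sub _ _).trans (add_le_add e2 e3))) ((abs_sub _ _).trans (add_le_add e4 e5))
        _ = 5 * ((u.len : ℝ) * (B * (K' ^ u.index * catProd u))) := by ring
    calc 1 / (N : ℝ) * |(u.len : ℝ) * Q u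
          + ((∑ o : SameIdx u, Q (u.negTwistAt o)) - ∑ o : InvIdx u, Q (u.posTwistAt o))
          + ((∑ o : MergeIdx u, P (u.negMergeAt o)) - ∑ o : MergeIdx u, P (u.posMergeAt o))|
        ≤ 1 / (N : ℝ) * (5 * ((u.len : ℝ) * (B * (K' ^ u.index * catProd u)))) :=
          mul_le_mul_of_nonneg_left hsrc (by positivity)
      _ = 5 * B / N * u.len * (K' ^ u.index * catProd u) := by field_simp
  -- contract
  have hη : (0 : ℝ) ≤ 5 * B / N := by positivity
  have hmain := contraction_iterate (β := β) hK'4 (by positivity : (0 : ℝ) ≤ 2 * B) hη hθ D hD0 Good hleaf hnode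
  intro t ht hball
  have hGt : Good m t := hball
  have h := hmain m t ht hGt
  have hΦ0 : 0 ≤ K' ^ t.index * catProd t := mul_nonneg (pow_nonneg hK'0 _) (catProd_nonneg _)
  -- `θ ≤ 3/4`, so `N θ^m ≤ N (3/4)^m ≤ 1/3`
  set θ : ℝ := 2 / K' + |β| * (2 * ((2 * (d - 1) : ℕ) : ℝ) * 256 * K' ^ 4) with hθdef
  have hθ0 : 0 ≤ θ := by positivity
  have hθm : (N : ℝ) * θ ^ m ≤ 1 / 3 := by
    have h1 : θ ^ m ≤ (3 / 4 : ℝ) ^ m := pow_le_pow_left₀ hθ0 hθ m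
    nlinarith [mul_le_mul_of_nonneg_left h1 hN0.le]
  rw [abs_mul, abs_of_pos hN0]
  calc (N : ℝ) * |D t| ≤ (N : ℝ) * ((2 * B * θ ^ m + 4 * (5 * B / N)) * (K' ^ t.index * catProd t)) :=
        mul_le_mul_of_nonneg_left h hN0.le
    _ = (2 * B * ((N : ℝ) * θ ^ m) + 20 * B) * (K' ^ t.index * catProd t) := by field_simp; ring
    _ ≤ (2 * B * (1 / 3) + 20 * B) * (K' ^ t.index * catProd t) := by gcongr
    _ ≤ 21 * B * (K' ^ t.index * catProd t) := mul_le_mul_of_nonneg_right (by linarith) hΦ0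

end StringDuality

end Summit.QuantumFields.GaugeBoot

end
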